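import Literature.MathematicalPhysics.QuantumFieldTheory.Balaban1983to89.B9SectEKernel
import Literature.MathematicalPhysics.QuantumFieldTheory.Balaban1983to89.B6Cov2156TorusDelK

/-!
# `Balaban1983to89.NodeOGamma0Road` — T. Bałaban, *Propagators for lattice gauge theories in a background field*, Commun. Math.
# Phys. **99** (1985) 389–434 [Balaban1985BackgroundPropagators] p. 428 (the `γ₀` sentence), (3.128)–(3.129) p. 421, (3.155)–(3.158)
# pp. 427–428, with [Balaban1984PropagatorsII] (2.153) p. 249, (2.157) p. 250: **THE FINITE-DIMENSIONAL ROAD FROM SEVEN LATTICE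
# LETTERS TO THE `γ₀` (`hcoer`) BINDER OF `C*Δ_kC`, AND ITS `U = 1` MEMBER INHABITED BY THE TREE's (2.157)**

statement-level skeleton of published theorems with citation tags; proofs where landed; nothing here is a claim about the Yang–Mills mass gap

CITATION HEADER (lean-in-tree rule).  Ideation cell `ym-nodeO-ideate` (portfolio track, 2026-08-25), seat P1 «inside Bałaban»,
memo `memos/ROUTE-P1.md` v3.14 §0n (FINDING F7).  LANDING EDITION v3 (generation 12) of the memo companion `memos/ROUTE-P1-SketchGamma0.lean`
(sha256 834bd7be… = 6aa950c2… + the n43 label repair; referee REF g18 PASS 2026-08-25T17:46:20Z, ROUND VERDICT 17:50:10Z name (2) =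
`hcoer_of_letters` + `hcoer_U1`; REF g19 countersign of edition v2 18:34:17Z; director-ym LINE №2 (B)): statements and proofs character-identical
to the frozen companion; edition deltas = the namespace, this header, the n43 labels (L4′a∕L4′b) in §G6's docstring, the companion's redundant
`open …Balaban1983to89` line dropped (ambiguous `open B6Cov2156TorusDelK (…)` inside the tree namespace), `private` on the two pure helpers
`dot_add_le` ∕ `toy_letters_inhabited`, and per-declaration `[cite:]` tags (LIT g6 map 2026-08-25T18:32:51Z, `lit/SOURCES.md` §1.13): EACH TAG
NAMES THE PRINTED STATEMENT THE LEMMA SERVES OR TRANSCRIBES — the proofs are our finite-dimensional algebra; print proves none of them as stated.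
Sources READ (renders, LIT `lit/SOURCES.md` v2.75 §1.3 l.111, §1.7 ll.146–148, §6): [B9] p. 428, p. 421, pp. 427–428; [B6] = CMP 96 p. 245, 249, 250.

PRINT STATUS (LIT §6 card, verbatim discipline).  `γ₀` for an ARBITRARY configuration `U`: **ASSERTED in print ([B9] p. 428: *«… a positive
definite operator C*Δ_kC with a lower bound γ₀ > 0 independent of k and U. We have proved it in [4], Lemma 2.4, for operators with U = 1.
Localizing the operators in Δ_k and using the methods of Sect. B we can prove it for C*Δ_kC with an arbitrary configuration U…»*), PROVED
NOWHERE** (pub-balaban GAPS G-B9-09; the written repair `pub-balaban/b2b-balaban-r1/SectE-interface-proof.md` Thm E1 is a repair MODULO printed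
inputs, not print).  `U = 1`: PROVED in print (CMP 96 (2.153) ⟹ (2.157) pp. 249–250) modulo Lemma 2.4, whose printed constant is under repair
(G-B6-09R); the tree's `B6Cov2156TorusDelK.ineq_2157_reDelK_sharp` is a kernel theorem.  Print NEVER states the seven lattice letters L1–L7
(covariant Stokes, `Q_k = M_k + E_k`, curl-by-energy, mass bound, local gauge step, good gauges, minimizer identities): they are E1's ∕ this
file's decomposition, displayed as HYPOTHESES; no theorem below is to be read as «[B9] p. 428 proves».

WHAT IS PROVED (sorry-free, axiom-free, `d`-generic except §U1's tree hypothesis `d ≥ 2`; real finite matrices, `Matrix.mulVec`, `dotProduct`).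
* §G0 `coercive_iff_hcoer` — the `hcoer` binder shape `∀ x, γ₀ Σ xᵢ² ≤ Σ xᵢ(P₀x)ᵢ` IS `QGQInverse.Coercive P₀ γ₀`; `posDef_of_coercive_symm`.
* §G1 `minimizer_form_eq`, `minimizer_identities` — (3.129): `QH = 1`, `G₁⁻¹H = QᵀP` ⟹ `Hᵀ(G₁⁻¹H) = P = (QG₁Qᵀ)⁻¹` ((3.156)).
* §G2 `deltaK_lower_realPoint` — `B9SectEKernel.gamma0_assembly` at the real point `𝐉 = 0` (no J-term): `Δ_k ≥ (c − κ₂)∕κ₁` on the admissible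
  subspace from (h1), (h2) alone.  §G3 `hcoer_realPoint`, `realPoint_isSymm`, `hpos_realPoint` — the `hcoer` letter for `P₀ = Cᵀ(Hᵀ(Gi₀H) − a)C`.
* §G4 `h1_of_letters` — (h1) from five matrix letters (E1 Prop. 5.4's algebra: L2 covariant Stokes for `M_k`, L3 `Q_k = M_k + E_k`, L1 curl-by-energy,
  L1′ mass bound, parallelogram bound of `F`).  §G5 `sum_sq_partition`, `h2_of_ims_letters` — (h2) from `B9SectEKernel.ims_lower` + the local letter.
* §G6 `local_step_of_gauge_letters` — E1 Lemma 5.5's algebra (L4′a∕L4′b gauge covariance, L5 = Lemma 2.4′ at `U = 1`, L4 one-step perturbation).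
* §G7 `realPoint_constant` — `(c∕4 − κ₂)∕κ₁ ≥ c∕320` for `κ₁ ≤ 40`, `κ₂ ≤ c∕8`.  §G8 **`hcoer_of_letters`** — THE TYPED END: letters L1–L7 ⟹ the
  `hcoer` binder with `γ₀ = ((c_loc − ε∕2) − κ₂)∕κ₁`.  §G9 `toy_letters_inhabited` (private) — the 21 letters are jointly satisfiable (one-bond toy, `γ₀ = 1∕2`).
* §U1 **`coercive_U1`, `hcoer_U1`** — the `U = 1` member INHABITED on every torus, every `n ≥ 1` (`L ∣ M_i`, `d ≥ 2`) by the tree's (2.157)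
  `B6Cov2156TorusDelK.ineq_2157_reDelK_sharp`, `γ₀ = gamma2153one d L = (1∕12d²)L^{−(d+1)}`.

LABELS used in the docstrings below: «E8» = the memo companion's graft theorem `acrossSmall_grafted` (binder `hcoer`), «W6» = the memo companion's
`MinimizerData.toGraft` (field `hpos`), «NODE 00» = the memo's name for the un-constructed objects — memo-side names (`memos/ROUTE-P1-Sketch*.lean`),
NOT tree declarations; in the tree the binder shape is `QGQInverse.Coercive` (§G0).  «E1» = pub-balaban's written repair named above.

WHAT THIS IS NOT.  NOT an inhabitant of `B13TermWalkDataOneTorus.ExistsUniformAcrossSmall` (:353) outright — the road reaches the `hcoer` binder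
(`QGQInverse.Coercive` shape of the memo's NODE O graft) MODULO the letters L1–L7, which are hypotheses here and are NOT supplied for Bałaban's operators
(NODE 00's objects: `G₁⁻¹`, `Q_k`, `D_U`, the minimizer, `C`); no YM-PLAN ∕ Track-B node is claimed closed and no Track-B number is produced; NOT [B12] Thm 2,
NOT NODE O; not infinite volume, not mass gap, not Clay.  NEW file importing `B9SectEKernel`, `B6Cov2156TorusDelK` (built); nothing modified.  Net new unproved facts: 0.
[cite: Balaban1985BackgroundPropagators, p.428, (3.155)–(3.158) pp.427–428, (3.128)–(3.129) p.421; Balaban1984PropagatorsII, Lemma 2.4 (2.128) p.245, (2.153) p.249,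
(2.157) p.250; CyconEtAl1987, Thm 3.2 (3.1) p.27; Balaban1985Averaging, Prop. 3 (124)–(126) p.36, (139)–(143) p.39; Balaban1985RegularSpaces, Thm 2 pp.82–83, Prop. 6 p.99] -/

namespace Literature.MathematicalPhysics.QuantumFieldTheory.Balaban1983to89.NodeOGamma0Road

open Matrix Finset
open Literature.MathematicalPhysics.QuantumFieldTheory.Balaban1983to89.QGQInverse (Coercive)
open Literature.MathematicalPhysics.QuantumFieldTheory.Balaban1983to89.B9SectEKernel

variable {n m p : Type*} [Fintype n] [DecidableEq n] [Fintype m] [DecidableEq m] [Fintype p] [DecidableEq p]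

/-! ## §G0. The road's `hcoer` binder shape is `Coercive` -/

omit [DecidableEq m] in
/-- E8's / `CoerciveInputs`' letter `∀ x, γ₀ Σ xᵢ² ≤ Σ xᵢ (P₀x)ᵢ` is `QGQInverse.Coercive P₀ γ₀`. [cite: Balaban1985BackgroundPropagators, p.428] -/
theorem coercive_iff_hcoer (P : Matrix m m ℝ) (γ : ℝ) :
    Coercive P γ ↔ ∀ x : m → ℝ, γ * ∑ i, x i ^ 2 ≤ ∑ i, x i * (P.mulVec x) i := by
  simp only [Coercive, dotProduct, sq]

omit [DecidableEq m] in
/-- A symmetric coercive real matrix with `γ > 0` is `PosDef` (W6's `hpos` from E8's `hcoer`; the symmetry proviso of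
memo v3.12, REF g14 n24). [cite: Balaban1985BackgroundPropagators, p.428] -/
theorem posDef_of_coercive_symm {P : Matrix m m ℝ} (hP : P.IsSymm) {γ : ℝ} (hγ : 0 < γ) (h : Coercive P γ) :
    P.PosDef := by
  refine Matrix.PosDef.of_dotProduct_mulVec_pos (Matrix.isHermitian_iff_isSymm.mpr hP) fun x hx => ?_
  have hxx : 0 < x ⬝ᵥ x := by
    have := dotProduct_star_self_pos_iff.mpr hx
    simpa using this
  have := h x
  simp only [star_trivial]
  exact lt_of_lt_of_le (mul_pos hγ hxx) this

/-! ## §G1. (3.129): the minimizer identities; W6's real-point operator is `(QG₁Qᵀ)⁻¹ − a` -/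

omit [DecidableEq n] in
/-- `QH = 1`, `SH = QᵀP` ⟹ `Hᵀ(SH) = P` (B9 (3.129), (3.155) → (3.156); cf. `B9SectEKernel.extension_energy`). [cite: Balaban1985BackgroundPropagators, (3.129) p.421, (3.155)–(3.156) pp.427–428] -/
theorem minimizer_form_eq (S : Matrix n n ℝ) (Q : Matrix m n ℝ) (H : Matrix n m ℝ) (P : Matrix m m ℝ)
    (hQH : Q * H = 1) (hSH : S * H = Qᵀ * P) : Hᵀ * (S * H) = P := by
  rw [hSH, ← Matrix.mul_assoc, ← Matrix.transpose_mul, hQH, Matrix.transpose_one, Matrix.one_mul]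

/-- The canonical pair `(H, P) := (S⁻¹Qᵀ(QS⁻¹Qᵀ)⁻¹, (QS⁻¹Qᵀ)⁻¹)` of (3.129) satisfies the two identities consumed by
`B9SectEKernel` (`hQH`, `hSH`), for `S` (playing `G₁⁻¹`) and `QS⁻¹Qᵀ` (playing `QG₁Qᵀ`) invertible. [cite: Balaban1985BackgroundPropagators, (3.129) p.421, (3.155)–(3.156) pp.427–428] -/
theorem minimizer_identities (S : Matrix n n ℝ) (Q : Matrix m n ℝ) (hS : IsUnit S) (hP : IsUnit (Q * S⁻¹ * Qᵀ)) :
    Q * (S⁻¹ * Qᵀ * (Q * S⁻¹ * Qᵀ)⁻¹) = 1 ∧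
      S * (S⁻¹ * Qᵀ * (Q * S⁻¹ * Qᵀ)⁻¹) = Qᵀ * (Q * S⁻¹ * Qᵀ)⁻¹ := by
  have hS' : IsUnit S.det := (Matrix.isUnit_iff_isUnit_det _).mp hS
  have hP' : IsUnit (Q * S⁻¹ * Qᵀ).det := (Matrix.isUnit_iff_isUnit_det _).mp hP
  constructor
  · simp only [← Matrix.mul_assoc]
    exact Matrix.mul_nonsing_inv _ hP'
  · simp only [← Matrix.mul_assoc]
    rw [Matrix.mul_nonsing_inv _ hS', Matrix.one_mul]

/-! ## §G2. `gamma0_assembly` at the real point `𝐉 = 0`: no J-term -/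

omit [DecidableEq n] in
/-- **Δ_k ≥ (c − κ₂)/κ₁ on the admissible subspace, at `𝐉 = 0`.** `Gi₀` = the real form `G₁⁻¹` ((3.128)), `Q` the averaging,
`a` the constant of `½a⟨B,B⟩`, `(H, P)` the minimizer pair ((3.129): `QH = 1`, `Gi₀H = QᵀP`), `good` the admissible subspace of
(3.156), `F` the covariant curvature functional of E1 §4; (h1) with `K := Gi₀ − aQᵀQ`, (h2) as in `gamma0_assembly`; the
J-term is ABSENT (`Jm = 0`, `θ = 0`: memo F3, [I] (1.8)–(1.9)). [cite: Balaban1985BackgroundPropagators, p.428, (3.156) p.428] -/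
theorem deltaK_lower_realPoint (Gi₀ : Matrix n n ℝ) (Q : Matrix m n ℝ) (a : ℝ) (H : Matrix n m ℝ) (P : Matrix m m ℝ)
    (hQH : Q * H = 1) (hSH : Gi₀ * H = Qᵀ * P) (good : (m → ℝ) → Prop) (F : (m → ℝ) → ℝ) {κ₁ κ₂ c : ℝ}
    (hκ₁ : 0 < κ₁)
    (h1 : ∀ A : n → ℝ, F (Q *ᵥ A) ≤ κ₁ * (A ⬝ᵥ ((Gi₀ - a • (Qᵀ * Q)) *ᵥ A)) + κ₂ * ((Q *ᵥ A) ⬝ᵥ (Q *ᵥ A)))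
    (h2 : ∀ B : m → ℝ, good B → c * (B ⬝ᵥ B) ≤ F B) (B : m → ℝ) (hB : good B) :
    (c - κ₂) / κ₁ * (B ⬝ᵥ B) ≤ B ⬝ᵥ ((Hᵀ * (Gi₀ * H) + (-a) • (1 : Matrix m m ℝ)) *ᵥ B) := by
  have hSH' : (Gi₀ - a • (Qᵀ * Q) + a • (Qᵀ * Q)) * H = Qᵀ * P := by rwa [sub_add_cancel]
  have h := gamma0_assembly (Gi₀ - a • (Qᵀ * Q)) Q a H P 0 hQH hSH' good F (θ := 0) hκ₁ h1 h2
    (fun B => by simp) B hB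
  have e : Hᵀ * (Gi₀ * H) + (-a) • (1 : Matrix m m ℝ) = P - a • 1 - 0 := by
    rw [minimizer_form_eq Gi₀ Q H P hQH hSH, sub_zero, neg_smul, sub_eq_add_neg]
  rw [e]
  simpa only [sub_zero] using h

/-! ## §G3. E8's `hcoer` letter and W6's `hpos` field for `P₀ = Cᵀ(H₀ᵀ(Gi₀H₀) + (−a)·1)C` -/

omit [DecidableEq n] [DecidableEq p] in
/-- **E8's `hcoer` AT THE ROAD'S REAL POINT from (h1), (h2) and the two sandwich letters of `C`** ((3.157): `C` maps into the
admissible subspace and `‖Cv‖ ≥ ‖v‖`; C-adv8-2 (i)) — in the binder's literal shape, `γ₀ = (c − κ₂)/κ₁`. [cite: Balaban1985BackgroundPropagators, (3.156)–(3.158) p.428] -/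
theorem hcoer_realPoint (Gi₀ : Matrix n n ℝ) (Q : Matrix m n ℝ) (a : ℝ) (H : Matrix n m ℝ) (P : Matrix m m ℝ)
    (hQH : Q * H = 1) (hSH : Gi₀ * H = Qᵀ * P) (good : (m → ℝ) → Prop) (F : (m → ℝ) → ℝ) {κ₁ κ₂ c : ℝ}
    (hκ₁ : 0 < κ₁) (hκ₂c : κ₂ ≤ c)
    (h1 : ∀ A : n → ℝ, F (Q *ᵥ A) ≤ κ₁ * (A ⬝ᵥ ((Gi₀ - a • (Qᵀ * Q)) *ᵥ A)) + κ₂ * ((Q *ᵥ A) ⬝ᵥ (Q *ᵥ A)))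
    (h2 : ∀ B : m → ℝ, good B → c * (B ⬝ᵥ B) ≤ F B)
    (C : Matrix m p ℝ) (hgood : ∀ v : p → ℝ, good (C *ᵥ v))
    (hC : ∀ v : p → ℝ, v ⬝ᵥ v ≤ (C *ᵥ v) ⬝ᵥ (C *ᵥ v)) :
    ∀ x : p → ℝ, (c - κ₂) / κ₁ * ∑ i, x i ^ 2 ≤
      ∑ i, x i * ((Cᵀ * (Hᵀ * (Gi₀ * H) + (-a) • (1 : Matrix m m ℝ)) * C).mulVec x) i := by
  rw [← coercive_iff_hcoer]
  exact coercive_sandwich_of_range _ C good (div_nonneg (sub_nonneg.mpr hκ₂c) hκ₁.le) hgood hC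
    (fun B hB => deltaK_lower_realPoint Gi₀ Q a H P hQH hSH good F hκ₁ h1 h2 B hB)

omit [DecidableEq n] [Fintype p] [DecidableEq p] in
/-- Symmetry of W6's real-point operator from the symmetry of `Gi₀`. [cite: Balaban1985BackgroundPropagators, (3.156)–(3.158) p.428] -/
theorem realPoint_isSymm (Gi₀ : Matrix n n ℝ) (hGi : Gi₀.IsSymm) (H : Matrix n m ℝ) (a : ℝ)
    (C : Matrix m p ℝ) : (Cᵀ * (Hᵀ * (Gi₀ * H) + (-a) • (1 : Matrix m m ℝ)) * C).IsSymm := by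
  unfold Matrix.IsSymm at hGi ⊢
  simp only [Matrix.transpose_mul, Matrix.transpose_add, Matrix.transpose_smul, Matrix.transpose_one,
    Matrix.transpose_transpose, hGi, Matrix.mul_assoc]

omit [DecidableEq n] [DecidableEq p] in
/-- **W6's `hpos` field** (`MinimizerData.hpos : (Cᵀ(H₀ᵀ(Gi₀H₀) + (−a)·1)C).PosDef`) from the same letters, when
`κ₂ < c` and `Gi₀` is symmetric. [cite: Balaban1985BackgroundPropagators, (3.156)–(3.158) p.428] -/
theorem hpos_realPoint (Gi₀ : Matrix n n ℝ) (hGi : Gi₀.IsSymm) (Q : Matrix m n ℝ) (a : ℝ) (H : Matrix n m ℝ)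
    (P : Matrix m m ℝ) (hQH : Q * H = 1) (hSH : Gi₀ * H = Qᵀ * P) (good : (m → ℝ) → Prop) (F : (m → ℝ) → ℝ)
    {κ₁ κ₂ c : ℝ} (hκ₁ : 0 < κ₁) (hκ₂c : κ₂ < c)
    (h1 : ∀ A : n → ℝ, F (Q *ᵥ A) ≤ κ₁ * (A ⬝ᵥ ((Gi₀ - a • (Qᵀ * Q)) *ᵥ A)) + κ₂ * ((Q *ᵥ A) ⬝ᵥ (Q *ᵥ A)))
    (h2 : ∀ B : m → ℝ, good B → c * (B ⬝ᵥ B) ≤ F B)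
    (C : Matrix m p ℝ) (hgood : ∀ v : p → ℝ, good (C *ᵥ v))
    (hC : ∀ v : p → ℝ, v ⬝ᵥ v ≤ (C *ᵥ v) ⬝ᵥ (C *ᵥ v)) :
    (Cᵀ * (Hᵀ * (Gi₀ * H) + (-a) • (1 : Matrix m m ℝ)) * C).PosDef :=
  posDef_of_coercive_symm (realPoint_isSymm Gi₀ hGi H a C) (div_pos (sub_pos.mpr hκ₂c) hκ₁)
    ((coercive_iff_hcoer _ _).mpr (hcoer_realPoint Gi₀ Q a H P hQH hSH good F hκ₁ hκ₂c.le h1 h2 C hgood hC))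

/-! ## §G4. (h1) from letters (E1 Prop. 5.4, the algebra) -/

omit [DecidableEq n] [DecidableEq m] [DecidableEq p] in
/-- **(h1) FROM LETTERS.** `K` = the form `G₁⁻¹ − aQᵀQ`; `Q = Mk + Ek` (reading R-M, letter L3: `Ek` is ℓ²-small); `D` = the
covariant exterior derivative `D_U` as a matrix; letters: `hF2` parallelogram bound of the curvature functional `F` (a sum of
squares of linear forms), `hCS` covariant lattice Stokes for the comparison average `Mk` (E1 Lemma CS / (5.2), letter L2),
`hEk` the curl of the error is norm-bounded (L3 with the plaquette bound), `hcurl` = (3.4) curl-by-energy (L1: (3.10)/(3.69) +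
Lemma 3.1 + (N′)), `hmass` = Lemma 3.1/3.3 mass bound (L1′).  Output: (h1) with `κ₁ = 2s₁k₁ + 2(e₁+e₂)c₁`,
`κ₂ = 2s₁k₂ + 2(e₁+e₂)c₂`. [cite: Balaban1985BackgroundPropagators, (3.10) p.392, Thm 3.3 (3.46) pp.398–399; Balaban1985Averaging, Prop. 3 (124)–(126) p.36, (139)–(143) p.39] -/
theorem h1_of_letters (K : Matrix n n ℝ) (Q Mk Ek : Matrix m n ℝ) (D : Matrix p n ℝ) (F : (m → ℝ) → ℝ)
    {s₁ e₁ e₂ k₁ k₂ c₁ c₂ : ℝ} (hs₁ : 0 ≤ s₁) (he : 0 ≤ e₁ + e₂) (hQ : Q = Mk + Ek)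
    (hF2 : ∀ B B' : m → ℝ, F (B + B') ≤ 2 * F B + 2 * F B')
    (hCS : ∀ A : n → ℝ, F (Mk *ᵥ A) ≤ s₁ * ((D *ᵥ A) ⬝ᵥ (D *ᵥ A)) + e₁ * (A ⬝ᵥ A))
    (hEk : ∀ A : n → ℝ, F (Ek *ᵥ A) ≤ e₂ * (A ⬝ᵥ A))
    (hcurl : ∀ A : n → ℝ, (D *ᵥ A) ⬝ᵥ (D *ᵥ A) ≤ k₁ * (A ⬝ᵥ (K *ᵥ A)) + k₂ * ((Q *ᵥ A) ⬝ᵥ (Q *ᵥ A)))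
    (hmass : ∀ A : n → ℝ, A ⬝ᵥ A ≤ c₁ * (A ⬝ᵥ (K *ᵥ A)) + c₂ * ((Q *ᵥ A) ⬝ᵥ (Q *ᵥ A))) :
    ∀ A : n → ℝ, F (Q *ᵥ A) ≤ (2 * s₁ * k₁ + 2 * (e₁ + e₂) * c₁) * (A ⬝ᵥ (K *ᵥ A))
      + (2 * s₁ * k₂ + 2 * (e₁ + e₂) * c₂) * ((Q *ᵥ A) ⬝ᵥ (Q *ᵥ A)) := by
  intro A
  have hQA : Q *ᵥ A = Mk *ᵥ A + Ek *ᵥ A := by rw [hQ, Matrix.add_mulVec]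
  have h0 := hF2 (Mk *ᵥ A) (Ek *ᵥ A)
  rw [← hQA] at h0
  have h5 : s₁ * ((D *ᵥ A) ⬝ᵥ (D *ᵥ A)) ≤ s₁ * (k₁ * (A ⬝ᵥ (K *ᵥ A)) + k₂ * ((Q *ᵥ A) ⬝ᵥ (Q *ᵥ A))) :=
    mul_le_mul_of_nonneg_left (hcurl A) hs₁
  have h6 : (e₁ + e₂) * (A ⬝ᵥ A) ≤ (e₁ + e₂) * (c₁ * (A ⬝ᵥ (K *ᵥ A)) + c₂ * ((Q *ᵥ A) ⬝ᵥ (Q *ᵥ A))) :=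
    mul_le_mul_of_nonneg_left (hmass A) he
  linarith [hCS A, hEk A]

/-! ## §G5. (h2) from IMS + the local letter (E1 Prop. 5.6, the algebra) -/

omit [DecidableEq m] in
/-- `Σ_s ‖h_s·B‖² = ‖B‖²` for a quadratic partition of unity. [cite: CyconEtAl1987, Thm 3.2 (3.1) p.27; Balaban1985BackgroundPropagators, p.428] -/
theorem sum_sq_partition {ι : Type*} [Fintype ι] (h : ι → m → ℝ) (hpart : ∀ i, ∑ s, h s i ^ 2 = 1) (B : m → ℝ) :
    ∑ s, (h s * B) ⬝ᵥ (h s * B) = B ⬝ᵥ B := by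
  simp only [dotProduct, Pi.mul_apply]
  rw [Finset.sum_comm]
  refine Finset.sum_congr rfl fun i _ => ?_
  have e : ∑ s, h s i * B i * (h s i * B i) = (B i * B i) * ∑ s, h s i ^ 2 := by
    rw [Finset.mul_sum]; exact Finset.sum_congr rfl fun s _ => by ring
  rw [e, hpart, mul_one]

omit [DecidableEq m] in
/-- **(h2) FROM LETTERS.** `Kf` = the matrix of the full local functional `F_V^{full}` (E1 Lemma 5.5: `L^{d−2}Σ|Q₁(V)B|² +
Σ|∂_VB|²`), `h` a quadratic partition of unity subordinate to doubled M-cubes with Schur letters `hrow`/`hcol ≤ ε` for the IMS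
error (`ε = O_{d,L}(M^{−2})`), the LOCAL LETTER `hloc` (Lemma 5.5 on each cube for admissible fields: letters L4–L5 via
`local_step_of_gauge_letters`), `good ⊆ adm` and `F ≥ F^{full}` on `good` (there `Q₁(V)B = 0`).  Output: (h2) with
`c_V = c − ε/2`. [cite: CyconEtAl1987, Thm 3.2 (3.1) p.27; Balaban1985BackgroundPropagators, p.428] -/
theorem h2_of_ims_letters {ι : Type*} [Fintype ι] (Kf : Matrix m m ℝ) (h : ι → m → ℝ)
    (hpart : ∀ i, ∑ s, h s i ^ 2 = 1) {ε c : ℝ} (hε : 0 ≤ ε)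
    (hrow : ∀ i, ∑ j, |Kf i j| * ∑ s, (h s i - h s j) ^ 2 ≤ ε)
    (hcol : ∀ j, ∑ i, |Kf i j| * ∑ s, (h s i - h s j) ^ 2 ≤ ε)
    (good adm : (m → ℝ) → Prop) (hga : ∀ B, good B → adm B)
    (hloc : ∀ s (B : m → ℝ), adm B → c * ((h s * B) ⬝ᵥ (h s * B)) ≤ (h s * B) ⬝ᵥ (Kf *ᵥ (h s * B)))
    (F : (m → ℝ) → ℝ) (hF : ∀ B, good B → B ⬝ᵥ (Kf *ᵥ B) ≤ F B) :
    ∀ B : m → ℝ, good B → (c - ε / 2) * (B ⬝ᵥ B) ≤ F B := by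
  intro B hB
  have hims := ims_lower Kf h hpart hε hrow hcol B
  have hloc' : c * (B ⬝ᵥ B) ≤ ∑ s, (h s * B) ⬝ᵥ (Kf *ᵥ (h s * B)) := by
    rw [← sum_sq_partition h hpart B, Finset.mul_sum]
    exact Finset.sum_le_sum fun s _ => hloc s B (hga B hB)
  have := hF B hB
  linarith

/-! ## §G6. The local step from gauge letters (E1 Lemma 5.5, the algebra) -/

/-- **LEMMA 5.5 FROM LETTERS.** On one doubled M-cube: `TV`, `TVu`, `T1` = the square-root forms `B′ ↦ (L^{(d−2)/2}Q₁(·)B′, ∂_{·}B′)` for the backgrounds `V`, `V^u`, `1`; `Ru` = the gauge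
transformation `B′ ↦ Ad(u(b₋))B′` (norm-preserving: L4′a); `hcov` = summand-wise gauge covariance ((3.29)–(3.32) pattern: L4′b); `hadm` = `Ru` preserves axiality and support; `h24` = Lemma 2.4′ at
`U = 1` (letter L5 — a tree THEOREM: `B6Lemma24Printed.lemma24_one` :609 (printed constant, every `L`) on `Z^d`, `B6Cov2156TorusDelK.lowerOnConstrainedT_reDelK_sharp` on the torus); `hpert` = the
one-step perturbation letter (L4: B7 (124)/(126) + `|∂_{e^{iW}} − ∂_1| ≤ 8ε_F max|B″|`, `δ = c₄ε_F`).  Output: `F_V^{full}(B′) ≥ (c/2 − δ²)‖B′‖²`. [cite: Balaban1985RegularSpaces, Thm 2 pp.82–83,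
Prop. 6 p.99; Balaban1985Averaging, (124)–(126) p.36; Balaban1984PropagatorsII, Lemma 2.4 (2.128) p.245] -/
theorem local_step_of_gauge_letters {E₁ F₁ : Type*} [SeminormedAddCommGroup E₁] [SeminormedAddCommGroup F₁]
    (TV TVu T1 : E₁ → F₁) (Ru : E₁ → E₁) (adm adm' : Set E₁) {c δ : ℝ}
    (hRu : ∀ b, ‖Ru b‖ = ‖b‖) (hcov : ∀ b, ‖TVu (Ru b)‖ = ‖TV b‖)
    (hadm : ∀ b ∈ adm, Ru b ∈ adm')
    (h24 : ∀ b ∈ adm', c * ‖b‖ ^ 2 ≤ ‖T1 b‖ ^ 2)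
    (hpert : ∀ b, ‖TVu b - T1 b‖ ≤ δ * ‖b‖) :
    ∀ b ∈ adm, (c / 2 - δ ^ 2) * ‖b‖ ^ 2 ≤ ‖TV b‖ ^ 2 := by
  intro b hb
  have hX0 : 0 ≤ ‖TV b‖ := norm_nonneg _
  have hY0 : 0 ≤ ‖T1 (Ru b)‖ := norm_nonneg _
  have hZ0 : 0 ≤ ‖TVu (Ru b) - T1 (Ru b)‖ := norm_nonneg _
  have hYXZ : ‖T1 (Ru b)‖ ≤ ‖TV b‖ + ‖TVu (Ru b) - T1 (Ru b)‖ := by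
    have e : T1 (Ru b) = TVu (Ru b) - (TVu (Ru b) - T1 (Ru b)) := by abel
    calc ‖T1 (Ru b)‖ = ‖TVu (Ru b) - (TVu (Ru b) - T1 (Ru b))‖ := by rw [← e]
      _ ≤ ‖TVu (Ru b)‖ + ‖TVu (Ru b) - T1 (Ru b)‖ := norm_sub_le _ _
      _ = ‖TV b‖ + ‖TVu (Ru b) - T1 (Ru b)‖ := by rw [hcov]
  have hY : c * ‖b‖ ^ 2 ≤ ‖T1 (Ru b)‖ ^ 2 := by
    have := h24 (Ru b) (hadm b hb); rwa [hRu] at this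
  have hZ : ‖TVu (Ru b) - T1 (Ru b)‖ ≤ δ * ‖b‖ := by
    have := hpert (Ru b); rwa [hRu] at this
  have hZ2 : ‖TVu (Ru b) - T1 (Ru b)‖ ^ 2 ≤ δ ^ 2 * ‖b‖ ^ 2 := by
    rw [← mul_pow]; exact pow_le_pow_left₀ hZ0 hZ 2
  have key : ‖T1 (Ru b)‖ ^ 2 / 2 - ‖TVu (Ru b) - T1 (Ru b)‖ ^ 2 ≤ ‖TV b‖ ^ 2 := by
    by_cases hYZ : ‖T1 (Ru b)‖ ≤ ‖TVu (Ru b) - T1 (Ru b)‖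
    · have : ‖T1 (Ru b)‖ ^ 2 ≤ ‖TVu (Ru b) - T1 (Ru b)‖ ^ 2 := pow_le_pow_left₀ hY0 hYZ 2
      nlinarith [sq_nonneg ‖TV b‖]
    · replace hYZ := not_le.mp hYZ
      have h1 : (‖T1 (Ru b)‖ - ‖TVu (Ru b) - T1 (Ru b)‖) ^ 2 ≤ ‖TV b‖ ^ 2 :=
        pow_le_pow_left₀ (by linarith) (by linarith) 2
      nlinarith [sq_nonneg (‖T1 (Ru b)‖ - 2 * ‖TVu (Ru b) - T1 (Ru b)‖)]
  linarith

/-! ## §G7. E1's constant at the real point -/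

/-- With `c_V ≥ c/4` (E1 Prop. 5.6), `κ₂ ≤ c/8`, `0 < κ₁ ≤ 40` (E1 Prop. 5.4) and NO J-term (`θ_J = 0` at `𝐉 = 0`):
`γ₀ = (c_V − κ₂)/κ₁ ≥ c/320` — twice E1's printed-route value `c/640` (which pays `θ_J ≤ c/640`). [cite: Balaban1985BackgroundPropagators, p.428] -/
theorem realPoint_constant {c cV κ₁ κ₂ : ℝ} (hc : 0 ≤ c) (hcV : c / 4 ≤ cV) (hκ₁ : 0 < κ₁) (hκ₁' : κ₁ ≤ 40)
    (hκ₂ : κ₂ ≤ c / 8) : c / 320 ≤ (cV - κ₂) / κ₁ := by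
  rw [le_div_iff₀ hκ₁]
  nlinarith

/-! ## §G8. THE TYPED END: letters L1–L7 ⟹ E8's `hcoer` -/

omit [DecidableEq n] [DecidableEq p] in
/-- **`γ₀` FROM THE LETTERS L1–L7 (memo §0n.4), in E8's binder shape.** Objects (NODE 00): `Gi₀` (real form (3.128)), `Q`
(composed averaging (3.13)–(3.15)), its split `Mk + Ek` (R-M), `D` (`D_U`), `a`, the minimizer pair `(H, P)` ((3.129)), `C`
((3.157)), `F` (E1 §4), `Kf` (Lemma 5.5's full local form), the partition `h`.  Letters: L7 `hQH`/`hSH`; L2 `hCS`; L3 `hEk`;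
L1 `hcurl`; L1′ `hmass`; `hF2`; IMS Schur letters `hrow`/`hcol`; L4–L5 packaged as `hloc`; `hga`, `hFfull`; L6 `hgood`/`hC`.
Conclusion: E8's `hcoer` for W6's `P₀` with `γ₀ = ((c_loc − ε/2) − κ₂)/κ₁`, `κ₁ = 2s₁k₁ + 2(e₁+e₂)c₁`,
`κ₂ = 2s₁k₂ + 2(e₁+e₂)c₂`. [cite: Balaban1985BackgroundPropagators, p.428, (3.155)–(3.158) pp.427–428] -/
theorem hcoer_of_letters {ι q : Type*} [Fintype ι] [Fintype q]
    (Gi₀ : Matrix n n ℝ) (Q Mk Ek : Matrix m n ℝ) (D : Matrix q n ℝ) (a : ℝ) (H : Matrix n m ℝ)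
    (P : Matrix m m ℝ) (C : Matrix m p ℝ) (F : (m → ℝ) → ℝ) (Kf : Matrix m m ℝ) (h : ι → m → ℝ)
    (good adm : (m → ℝ) → Prop) {s₁ e₁ e₂ k₁ k₂ c₁ c₂ ε cloc : ℝ}
    -- L7: the minimizer identities (3.129)
    (hQH : Q * H = 1) (hSH : Gi₀ * H = Qᵀ * P)
    -- (h1)-side letters
    (hs₁ : 0 ≤ s₁) (he : 0 ≤ e₁ + e₂) (hQ : Q = Mk + Ek)
    (hF2 : ∀ B B' : m → ℝ, F (B + B') ≤ 2 * F B + 2 * F B')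
    (hCS : ∀ A : n → ℝ, F (Mk *ᵥ A) ≤ s₁ * ((D *ᵥ A) ⬝ᵥ (D *ᵥ A)) + e₁ * (A ⬝ᵥ A))
    (hEk : ∀ A : n → ℝ, F (Ek *ᵥ A) ≤ e₂ * (A ⬝ᵥ A))
    (hcurl : ∀ A : n → ℝ, (D *ᵥ A) ⬝ᵥ (D *ᵥ A) ≤
      k₁ * (A ⬝ᵥ ((Gi₀ - a • (Qᵀ * Q)) *ᵥ A)) + k₂ * ((Q *ᵥ A) ⬝ᵥ (Q *ᵥ A)))
    (hmass : ∀ A : n → ℝ, A ⬝ᵥ A ≤ c₁ * (A ⬝ᵥ ((Gi₀ - a • (Qᵀ * Q)) *ᵥ A)) + c₂ * ((Q *ᵥ A) ⬝ᵥ (Q *ᵥ A)))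
    -- (h2)-side letters
    (hpart : ∀ i, ∑ s, h s i ^ 2 = 1) (hε : 0 ≤ ε)
    (hrow : ∀ i, ∑ j, |Kf i j| * ∑ s, (h s i - h s j) ^ 2 ≤ ε)
    (hcol : ∀ j, ∑ i, |Kf i j| * ∑ s, (h s i - h s j) ^ 2 ≤ ε)
    (hga : ∀ B, good B → adm B)
    (hloc : ∀ s (B : m → ℝ), adm B → cloc * ((h s * B) ⬝ᵥ (h s * B)) ≤ (h s * B) ⬝ᵥ (Kf *ᵥ (h s * B)))
    (hFfull : ∀ B, good B → B ⬝ᵥ (Kf *ᵥ B) ≤ F B)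
    -- L6: the sandwich letters of C
    (hgood : ∀ v : p → ℝ, good (C *ᵥ v)) (hC : ∀ v : p → ℝ, v ⬝ᵥ v ≤ (C *ᵥ v) ⬝ᵥ (C *ᵥ v))
    -- positivity of the resulting constant
    (hκ₁ : 0 < 2 * s₁ * k₁ + 2 * (e₁ + e₂) * c₁)
    (hγ : 2 * s₁ * k₂ + 2 * (e₁ + e₂) * c₂ ≤ cloc - ε / 2) :
    ∀ x : p → ℝ, ((cloc - ε / 2) - (2 * s₁ * k₂ + 2 * (e₁ + e₂) * c₂)) / (2 * s₁ * k₁ + 2 * (e₁ + e₂) * c₁) *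
        ∑ i, x i ^ 2 ≤ ∑ i, x i * ((Cᵀ * (Hᵀ * (Gi₀ * H) + (-a) • (1 : Matrix m m ℝ)) * C).mulVec x) i :=
  hcoer_realPoint Gi₀ Q a H P hQH hSH good F hκ₁ hγ
    (h1_of_letters (Gi₀ - a • (Qᵀ * Q)) Q Mk Ek D F hs₁ he hQ hF2 hCS hEk hcurl hmass)
    (h2_of_ims_letters Kf h hpart hε hrow hcol good adm hga hloc F hFfull) C hgood hC

/-! ## §G9. Non-vacuity: the 21 letters of `hcoer_of_letters` are JOINTLY SATISFIABLE (1 × 1 toy) -/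

omit [DecidableEq m] in
/-- The parallelogram bound `‖B + B′‖² ≤ 2‖B‖² + 2‖B′‖²` (the letter `hF2` for `F = ‖·‖²`; for a general sum of squares of
linear forms apply it form by form). [folklore] -/
private theorem dot_add_le (B B' : m → ℝ) : (B + B') ⬝ᵥ (B + B') ≤ 2 * (B ⬝ᵥ B) + 2 * (B' ⬝ᵥ B') := by
  have h0 : 0 ≤ (B - B') ⬝ᵥ (B - B') := Finset.sum_nonneg fun i _ => mul_self_nonneg _
  simp only [sub_dotProduct, dotProduct_sub, add_dotProduct, dotProduct_add, dotProduct_comm B' B] at h0 ⊢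
  linarith

/-- **JOINT SATISFIABILITY OF THE END'S LETTERS** on `Fin 1` (all objects `1`/`0`, `Gi₀ = P = 2·1`, `a = 1`, `F = ‖·‖²`,
one partition function `≡ 1`): the 21 letters of `hcoer_of_letters` hold together and the END returns `γ₀ = 1/2 > 0` for
`P₀ = 1ᵀ(1ᵀ(2·1·1) + (−1)·1)1 = 1`. [folklore] -/
private theorem toy_letters_inhabited :
    ∃ γ₀ : ℝ, 0 < γ₀ ∧ ∀ x : Fin 1 → ℝ, γ₀ * ∑ i, x i ^ 2 ≤
      ∑ i, x i * (((1 : Matrix (Fin 1) (Fin 1) ℝ)ᵀ *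
        ((1 : Matrix (Fin 1) (Fin 1) ℝ)ᵀ * (((2 : ℝ) • (1 : Matrix (Fin 1) (Fin 1) ℝ)) * 1) +
          (-(1 : ℝ)) • (1 : Matrix (Fin 1) (Fin 1) ℝ)) * 1).mulVec x) i := by
  refine ⟨_, ?_, hcoer_of_letters (ι := Fin 1) (q := Fin 1) ((2 : ℝ) • (1 : Matrix (Fin 1) (Fin 1) ℝ))
    (1 : Matrix (Fin 1) (Fin 1) ℝ) 1 0 (1 : Matrix (Fin 1) (Fin 1) ℝ) (1 : ℝ) (1 : Matrix (Fin 1) (Fin 1) ℝ)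
    ((2 : ℝ) • (1 : Matrix (Fin 1) (Fin 1) ℝ)) (1 : Matrix (Fin 1) (Fin 1) ℝ) (fun B => B ⬝ᵥ B)
    (1 : Matrix (Fin 1) (Fin 1) ℝ) (fun _ => 1) (fun _ => True) (fun _ => True)
    (s₁ := 1) (e₁ := 0) (e₂ := 0) (k₁ := 1) (k₂ := 0) (c₁ := 1) (c₂ := 0) (ε := 0) (cloc := 1)
    ?_ ?_ ?_ ?_ ?_ ?_ ?_ ?_ ?_ ?_ ?_ ?_ ?_ ?_ ?_ ?_ ?_ ?_ ?_ ?_ ?_⟩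
  · norm_num
  · simp                                  -- hQH
  · simp                                  -- hSH
  · norm_num                              -- hs₁
  · norm_num                              -- he
  · simp                                  -- hQ
  · exact fun B B' => dot_add_le B B'     -- hF2
  · intro A; simp                         -- hCS
  · intro A; simp                         -- hEk
  · intro A; simp [two_smul]              -- hcurl
  · intro A; simp [two_smul]              -- hmass
  · intro i; simp                         -- hpart
  · norm_num                              -- hε
  · intro i; simp                         -- hrow
  · intro j; simp                         -- hcol
  · exact fun _ _ => trivial              -- hga
  · intro s B _; simp                     -- hloc
  · intro B _; simp                       -- hFfull
  · exact fun _ => trivial                -- hgood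
  · intro v; simp                         -- hC
  · norm_num                              -- hκ₁
  · norm_num                              -- hγ

/-! ## §U1. The `U = 1` member: E8's `hcoer` shape INHABITED by a tree theorem -/

section U1

open B6Cov2156TorusDelK (reDelK gamma2153one ineq_2157_reDelK_sharp)
open B6Cov2156Torus (freeT elimT)

variable {d L : ℕ} {M : Fin d → ℕ} [∀ μ, NeZero (M μ)]

/-- **`U = 1`: C*Δ_kC IS COERCIVE WITH γ₀ = (1/12d²)L^{−(d+1)} ON EVERY TORUS, EVERY `n`** — the tree's kernel-checked
(2.157) (`B6Cov2156TorusDelK.ineq_2157_reDelK_sharp`: genuine `Re Δ_k` of (1.65)/(2.152) in the bond basis, `elimT` = the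
parametrisation `C` of the constrained axial fields), repackaged as `Coercive`.  `d ≥ 2`, `L ≥ 1`, `L ∣ M_i`, `n ≥ 1`.
[cite: Balaban1984PropagatorsII, (2.157) p.250, (2.153) p.249] -/
theorem coercive_U1 (hd : 2 ≤ d) (hL : 1 ≤ L) (hLM : ∀ i, L ∣ M i) (n : ℕ) (hn : 1 ≤ n) :
    Coercive ((elimT L M)ᵀ * reDelK n hn M * elimT L M) (gamma2153one d L) := by
  intro w
  have h := ineq_2157_reDelK_sharp hd hL hLM n hn w
  have e : w ⬝ᵥ w = ∑ f, w f ^ 2 := by simp only [dotProduct, sq]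
  rw [e]
  exact h.2.trans h.1

/-- The same in E8's binder shape (`CoerciveInputs.hcoer` / `acrossSmall_grafted`'s `hcoer`): the road's `γ₀` letter is
inhabited at `U = 1` with the explicit `γ₀ = gamma2153one d L = (1/12d²)L^{−(d+1)}`, uniformly in `n` (all `k`) and in the
torus. [cite: Balaban1984PropagatorsII, (2.157) p.250] -/
theorem hcoer_U1 (hd : 2 ≤ d) (hL : 1 ≤ L) (hLM : ∀ i, L ∣ M i) (n : ℕ) (hn : 1 ≤ n) :
    ∀ w : freeT L M → ℝ, gamma2153one d L * ∑ f, w f ^ 2 ≤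
      ∑ f, w f * (((elimT L M)ᵀ * reDelK n hn M * elimT L M).mulVec w) f :=
  (coercive_iff_hcoer _ _).mp (coercive_U1 hd hL hLM n hn)

/-- Its value: `gamma2153one d L = 1/(12d²)·L^{−(d+1)}` (d-generic; `d = 3`: `L^{−4}/108`, `d = 4`: `L^{−5}/192`). [folklore] -/
example (d L : ℕ) : gamma2153one d L = 1 / (12 * (d : ℝ) ^ 2) * (L : ℝ) ^ (-((d : ℝ) + 1)) := rfl

end U1

end Literature.MathematicalPhysics.QuantumFieldTheory.Balaban1983to89.NodeOGamma0Road
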